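import Summits.BirchSwinnertonDyer.Rank1Residual.O5.HeegnerLogTransportThreeHeegnerIndexEnd
import Summits.BirchSwinnertonDyer.Rank1Residual.O5.HeegnerLogTransportThreeLogUnitCertCore
import Summits.BirchSwinnertonDyer.Rank1Residual.Supersingular.RationalLadder
import HarnessLib
import HarnessLib.Audit.Tags

/-!
# Heegner-log transport at `p = 3` (KL3), part 27c: the HEEGNER-INDEX END's unit-log binder as a KERNEL
# CERTIFICATE (rational multiple `m • Q₀ = (x_R, y_R)`, `ord₃ x_R = −2k`, part 24 core) with the tree's
# rational LADDER as division-free front-end — good ordinary OR SUPERSINGULAR companion — o5-r2 GEN 29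

HONEST FRAMING (cell `b2b-bsdres`, run/shared/lean/b2b/bsd-rank1-residual/, verbatim in every file): the
goal of the cell is to DELETE the COMBINATION-SHAPED residual classes of the Birch–Swinnerton-Dyer formula
for ALL analytic-rank `≤ 1` elliptic curves over `ℚ` — "full BSD formula for every rank `≤ 1` curve in
class `C`" assembled STRICTLY from published theorems — so that the rank-`≤ 1` remainder becomes exactly
the CONSTRUCTION-SHAPED classes, which are TYPED (missing-input `Prop`s), NOT attempted. This is not
"finishing BSD". Team O5 (tame potentially supersingular additive `p = 3`, (t′)), planner o5-r2 (the
non-Iwasawa side), GEN 29; RESEARCH ROUTE; THEOREMS ONLY (bookkeeping over explicit hypotheses): no new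
node is WANTED, no Literature fact, no `@[conjecture]`, no new object; NOTHING is booked and no mark of
`RESIDUAL-MAP.md` moves. O5 OPEN.

## What this file does (memo `HOME/b2b-bsdres-o5-r2/gen29/O5-GEN29.md`)

Part 27b (`O5/HeegnerLogTransportThreeHeegnerIndexEnd.lean`, o5-r2 GEN 28, theorem
`o5_index_unit_of_good_companion_heegnerIndex_rat`) is the HEEGNER-INDEX END: for a (t′) curve `W` and a
mod-`3` congruent companion `G` with GOOD reduction at `3` (ordinary OR supersingular), the companion's
Heegner index prime to `3` (`hIdx : 3 ∤ [G(K) : ℤP′]`) and a rational point `Q₀ ∈ G(ℚ)` `3`-primitive in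
Kriz–Li's normalisation transport to `3 ∤ [W(K) : ℤP]`, ASSUMING ONLY Kriz–Li Thm. 1.16 (`hKL`) and
modularity (`hmod`). This file does for 27b what part 25b did for part 25: the unit-log binder
`ord₃ padicLog_{G ⊗ ℚ₃}(Q₀ ⊗ ℚ₃) + ord₃ |G̃^{ns}(𝔽₃)| − 1 = 0` becomes a FINITE EXACT COMPUTATION by part 24
core (`valuation_padicLog_of_nsmul_eq`: odd `p`, `m • Q = (x_R, y_R)`, `ord_p x_R = −2k`, `k ≥ 1` ⇒
`padicLog Q ≠ 0 ∧ ord_p padicLog Q = k − ord_p m`): §3 takes `m • Q₀ = (x_R, y_R)`, `0 < k`,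
`padicValRat 3 x_R = −2k` and the numeral identity `k − ord₃ m + ord₃ |G̃^{ns}(𝔽₃)| − 1 = 0` (and PROVES
`Q₀` has infinite order); §4 supplies the point equality by the tree's rational ladder
(`Supersingular.nsmul_some_eq_of_ladderRunQ`, `decide +kernel` per row). For a SUPERSINGULAR companion
`a₃(G) = 0`, `|G̃(𝔽₃)| = 4`, so `ord₃ |G̃^{ns}(𝔽₃)| = 0` and the side condition reads `k = 1 + ord₃ m`; the
natural choice is `m = 4` (two doubling steps), `k = 1`. Census C (EVIDENCE, memo GEN 28 §4, kit j193386):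
the supersingular companions `2576l1/−551` and `48841a1/−263` of the four `𝓛 = 0` pairs have `k_log = 1`
and `ord₃ [G(K) : ℤP′] = 0` (`n = −16`, `−32`); their row files are this generation's docket (i), after
this file.

## TYPER PLACEMENT NOTE

Place as `O5/HeegnerLogTransportThreeHeegnerIndexEndCert.lean` AFTER part 27b
(`O5/HeegnerLogTransportThreeHeegnerIndexEnd.lean`, o5-r2 GEN 28, ask A-O5-G28-1 (b)) and part 24 core
(`O5/HeegnerLogTransportThreeLogUnitCertCore.lean`, in the tree), plus `Supersingular/RationalLadder.lean`
(in the tree), which this file imports; THEOREMS only, namespace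
`Summit.BirchSwinnertonDyer.Rank1Residual.O5.HeegnerLogTransport`; no `def`.
CONTENT LABELS: THEOREMS ONLY — 0 `def`, 0 `@[conjecture]`, 0 Literature facts (net named-fact debt 0),
no `sorry`; published inputs stay displayed hypotheses BY NAME. HONEST FRAMING as above; census = EVIDENCE,
never a Literature fact; O5 OPEN; nothing booked.

### cc-typer-5 GEN 20 (O5 §3.5 / O6 §3.4 typer of record) — by-name ask A-O5-G29-1 (a) of o5-r2 GEN 29 (HOME/INBOX.md l.15286 / P.S. l.15310 / l.15330): '27c 43b506fea2c298af →
O5/HeegnerLogTransportThreeHeegnerIndexEndCert.lean' (by sha, VERBATIM + ¶; memo gen29/O5-GEN29.md). Source: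
`HOME/b2b-bsdres-o5-r2/gen29/lean/HeegnerLogTransportThreeHeegnerIndexEndCert.lean` sha16 `43b506fea2c298af` (169 l.; `gen29/SHA16.txt`; o5-r2's farm checks rc 0 / 0 warnings / 0
sorries, axioms standard, dedup clean as stated in their line), re-hashed by the typer right before writing; THIS file = the source VERBATIM + this paragraph (imports, module
text, every declaration block byte-identical; script `class-closure/typer-5/gen20/gplace.py`, docstring anchor asserted); imports `O5.HeegnerLogTransportThreeHeegnerIndexEnd`,
`O5.HeegnerLogTransportThreeLogUnitCertCore`, `Supersingular.RationalLadder` — all in the tree at filing; the typer's own standalone farm check on tree imports (rc 0 / 0 warnings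
/ 0 sorries; `#print axioms` of the END(s) standard) and DEDUP (`lean search --decl` on the 2 new names: no match; the gate's statement-level dedup at dry-run) precede the
proposal. CONTENT LABELS: as the source's module text above states (declarations: `o5_index_unit_of_good_companion_heegnerIndex_cert`,
`o5_index_unit_of_good_companion_heegnerIndex_ladder`); 0 `@[conjecture]`, 0 Literature facts (net named-fact debt 0), no `sorry`; published inputs stay displayed hypotheses BY
NAME, nothing re-proved. HONEST FRAMING (cell `b2b-bsdres`): research route, lane CLASS-CLOSURE §3.5 O5; CONDITIONAL ENDs — nothing asserted beyond the displayed binders, nothing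
booked, no mark / label / count / tier of `RESIDUAL-MAP.md` moves; census / instrument statements = EVIDENCE or displayed binders, never a Literature fact; O5 OPEN.
-/

set_option autoImplicit false

noncomputable section

open scoped Classical

open WeierstrassCurve Literature.NumberTheory.EllipticCurves
  Literature.NumberTheory.EllipticCurves.ModularForms
  Literature.NumberTheory.EllipticCurves.Rank1Residual
  Literature.NumberTheory.EllipticCurves.Rank1Residual.Typed
open Summit.BirchSwinnertonDyer.Rank1Residual.X11b (embAt)
open Summit.BirchSwinnertonDyer.Rank1Residual.Additive.LocalLog
open IsDedekindDomain (HeightOneSpectrum)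
open scoped NumberField

namespace Summit.BirchSwinnertonDyer.Rank1Residual.O5.HeegnerLogTransport

/-! ## §3 The unit-log binder as a KERNEL CERTIFICATE: a rational multiple `m • Q₀ = (x_R, y_R)` (part 24 §3) -/

/-- **Heegner-index END, rational-multiple certificate.** Part 27b §2 with `hQ₀`, `hQ₀unit` REPLACED by:
`m • Q₀ = (x_R, y_R) ∈ G(ℚ)` with `ord₃ x_R = −2k`, `0 < k`, and the arithmetic side condition
`k − ord₃ m + ord₃ |G̃^{ns}(𝔽₃)| − 1 = 0` (for a good companion and the natural choice `m = |G̃(𝔽₃)|`,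
`k = 1` it reads `0 = 0`; for a supersingular companion `|G̃(𝔽₃)| = 4`). Part 24's
`valuation_padicLog_of_nsmul_eq` (odd `p`: `ord_p padicLog Q₀ = k − ord_p m`, and `padicLog Q₀ ≠ 0`, so
`Q₀` has infinite order) turns these into 27b's binders. Every hypothesis on `Q₀` is now an identity
between rational numerals; the companion's Heegner index `hIdx` stays displayed.
[cite: SilvermanAEC2009, IV.6.4 and VII.2.2] [cite: Castella2018, §2.2 and Thm. 2.3 (arXiv:1704.06608 p. 5)]
[cite: KrizLi2019, Thm. 1.16, Rem. 1.17] [cite: GrossZagier1986, §V.2 (pp. 310–312)] -/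
theorem o5_index_unit_of_good_companion_heegnerIndex_cert
    (hKL : KrizLi2019.thm116_padicLogHeegner_congruence) (hmod : exists_isNewformOf)
    (W G : WeierstrassCurve ℚ) [W.IsElliptic] [W.IsGloballyMinimal] [G.IsElliptic] [G.IsGloballyMinimal]
    (hcong : ∀ ℓ : ℕ, ℓ.Prime → ¬ (ℓ ∣ 3 * W.conductorNorm ℤ * G.conductorNorm ℤ) →
      ((W.LFunction ℓ : ℤ) : ZMod 3) = ((G.LFunction ℓ : ℤ) : ZMod 3))
    (hρ : W.HasSurjectiveModNGaloisRep 3) (hadd : Addv W 3)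
    (hunitW : ∀ ℓ ∈ klSet W G, ℓ ≠ 3 → padicValInt 3 (nsCount W ℓ) = 0)
    (hunitG : ∀ ℓ ∈ klSet G W, ℓ ≠ 3 → padicValInt 3 (nsCount G ℓ) = 0)
    (htam : ¬ 3 ∣ W.tamagawaProduct) (hgoodG : G.HasGoodReductionAtPrime 3)
    {N N' : ℕ} [NeZero N] [NeZero N'] (D : ModularParametrizationData W N)
    (D' : ModularParametrizationData G N')
    (K : Type) [Field K] [NumberField K] (hK : IsImaginaryQuadratic K)
    (hH : SatisfiesHeegnerHypothesis N K) (hH' : SatisfiesHeegnerHypothesis N' K)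
    (h3K : SatisfiesHeegnerHypothesis 3 K) (hd : NumberField.discr K < -4)
    (H : HeegnerDatum N (NumberField.discr K)) (H' : HeegnerDatum N' (NumberField.discr K))
    (ι : K →+* ℂ) (ι₃ : K →+* ℚ_[3])
    (P : (W.baseChange K).toAffine.Point) (P' : (G.baseChange K).toAffine.Point)
    (hP : WeierstrassCurve.Affine.Point.map ι.toRatAlgHom P = heegnerPointComplex D H)
    (hP' : WeierstrassCurve.Affine.Point.map ι.toRatAlgHom P' = heegnerPointComplex D' H')
    (hPinf : ¬ IsOfFinAddOrder P) (hP'inf : ¬ IsOfFinAddOrder P')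
    (Q₀ : G.toAffine.Point) {xR yR : ℚ} {hR : G.toAffine.Nonsingular xR yR} {m k : ℕ}
    (hm : m • Q₀ = .some xR yR hR) (hk : 0 < k) (hx : padicValRat 3 xR = -(2 * (k : ℤ)))
    (hmk : (k : ℤ) - padicValNat 3 m + padicValInt 3 (nsCount G 3) - 1 = 0)
    (hIdx : ¬ 3 ∣ (AddSubgroup.zmultiples P').index)
    (hcD : padicValInt 3 D.maninConstant = 0) (hc3' : ¬ ((3 : ℤ) ∣ D'.maninConstant)) :
    padicValNat 3 (AddSubgroup.zmultiples P).index = 0 := by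
  haveI : Fact (Nat.Prime 3) := ⟨Nat.prime_three⟩
  have hm' : m • Affine.Point.map (W' := G.toAffine) (S := ℚ) (Algebra.ofId ℚ ℚ_[3]) Q₀ =
      Affine.Point.map (W' := G.toAffine) (S := ℚ) (Algebra.ofId ℚ ℚ_[3]) (.some xR yR hR) := by
    rw [← map_nsmul]; exact congrArg _ hm
  rw [Affine.Point.map_some] at hm'
  have hx' : ((Algebra.ofId ℚ ℚ_[3]) xR).valuation = -(2 * (k : ℤ)) := by
    rw [show (Algebra.ofId ℚ ℚ_[3]) xR = (xR : ℚ_[3]) from eq_ratCast _ xR, Padic.valuation_ratCast, hx]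
  obtain ⟨hnt, hval⟩ :=
    valuation_padicLog_of_nsmul_eq (G.baseChange ℚ_[3]) (by norm_num) hm' hk hx'
  have hQ₀ : ¬ IsOfFinAddOrder Q₀ := fun h =>
    hnt ((padicLog_eq_zero_iff (G.baseChange ℚ_[3]) _).mpr (AddMonoidHom.isOfFinAddOrder _ h))
  have hQ₀unit : (padicLog (G.baseChange ℚ_[3])
        (Affine.Point.map (W' := G.toAffine) (S := ℚ) (Algebra.ofId ℚ ℚ_[3]) Q₀)).valuation +
      padicValInt 3 (nsCount G 3) - 1 = 0 := by
    rw [hval]; exact hmk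
  exact o5_index_unit_of_good_companion_heegnerIndex_rat hKL hmod W G hcong hρ hadd hunitW hunitG htam hgoodG
    D D' K hK hH hH' h3K hd H H' ι ι₃ P P' hP hP' hPinf hP'inf Q₀ hQ₀ hQ₀unit hIdx hcD hc3'

/-! ## §4 Division-free front-end: the multiple by a tree LADDER (`Supersingular.ladderRunQ`, `decide +kernel`) -/

/-- **Heegner-index END, ladder form of the unit-log certificate.** §3 with the point equality
`m • Q₀ = (x_R, y_R)` SUPPLIED by the tree's rational ladder: a base point `(x₀, y₀) ∈ G(ℚ)` (`h₀`,
`decide`), a list of ladder steps replayed by `Supersingular.ladderRunQ` to `(x_f, y_f)` (`hrun`,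
`decide +kernel`), `m = qScalar 1 steps`, and the two numeral checks `padicValRat 3 x_f = −2k`,
`k − ord₃ m + ord₃ |G̃^{ns}(𝔽₃)| − 1 = 0`. For a good ordinary companion take `m = |G̃(𝔽₃)| ∈ {2, 4, 5, 7}`
(non-anomalous, `k = 1`) or `m ∈ {3, 6}` (anomalous, `k = 1`); for a SUPERSINGULAR companion `m = 4`
(two doubling steps, `k = 1`) or `m = 2` when `Q̃₀` has order `2` in `G̃(𝔽₃)`.
[cite: SilvermanAEC2009, III.2.3, IV.6.4 and VII.2.2] [cite: KrizLi2019, Thm. 1.16, Rem. 1.17] -/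
theorem o5_index_unit_of_good_companion_heegnerIndex_ladder
    (hKL : KrizLi2019.thm116_padicLogHeegner_congruence) (hmod : exists_isNewformOf)
    (W G : WeierstrassCurve ℚ) [W.IsElliptic] [W.IsGloballyMinimal] [G.IsElliptic] [G.IsGloballyMinimal]
    (hcong : ∀ ℓ : ℕ, ℓ.Prime → ¬ (ℓ ∣ 3 * W.conductorNorm ℤ * G.conductorNorm ℤ) →
      ((W.LFunction ℓ : ℤ) : ZMod 3) = ((G.LFunction ℓ : ℤ) : ZMod 3))
    (hρ : W.HasSurjectiveModNGaloisRep 3) (hadd : Addv W 3)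
    (hunitW : ∀ ℓ ∈ klSet W G, ℓ ≠ 3 → padicValInt 3 (nsCount W ℓ) = 0)
    (hunitG : ∀ ℓ ∈ klSet G W, ℓ ≠ 3 → padicValInt 3 (nsCount G ℓ) = 0)
    (htam : ¬ 3 ∣ W.tamagawaProduct) (hgoodG : G.HasGoodReductionAtPrime 3)
    {N N' : ℕ} [NeZero N] [NeZero N'] (D : ModularParametrizationData W N)
    (D' : ModularParametrizationData G N')
    (K : Type) [Field K] [NumberField K] (hK : IsImaginaryQuadratic K)
    (hH : SatisfiesHeegnerHypothesis N K) (hH' : SatisfiesHeegnerHypothesis N' K)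
    (h3K : SatisfiesHeegnerHypothesis 3 K) (hd : NumberField.discr K < -4)
    (H : HeegnerDatum N (NumberField.discr K)) (H' : HeegnerDatum N' (NumberField.discr K))
    (ι : K →+* ℂ) (ι₃ : K →+* ℚ_[3])
    (P : (W.baseChange K).toAffine.Point) (P' : (G.baseChange K).toAffine.Point)
    (hP : WeierstrassCurve.Affine.Point.map ι.toRatAlgHom P = heegnerPointComplex D H)
    (hP' : WeierstrassCurve.Affine.Point.map ι.toRatAlgHom P' = heegnerPointComplex D' H')
    (hPinf : ¬ IsOfFinAddOrder P) (hP'inf : ¬ IsOfFinAddOrder P')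
    {x₀ y₀ xf yf : ℚ} (h₀ : G.toAffine.Nonsingular x₀ y₀) (steps : List Supersingular.QStep)
    (hrun : Supersingular.ladderRunQ G.a₁ G.a₂ G.a₃ G.a₄ x₀ y₀ x₀ y₀ steps = some (xf, yf))
    {k : ℕ} (hk : 0 < k) (hx : padicValRat 3 xf = -(2 * (k : ℤ)))
    (hmk : (k : ℤ) - padicValNat 3 (Supersingular.qScalar 1 steps) + padicValInt 3 (nsCount G 3) - 1 = 0)
    (hIdx : ¬ 3 ∣ (AddSubgroup.zmultiples P').index)
    (hcD : padicValInt 3 D.maninConstant = 0) (hc3' : ¬ ((3 : ℤ) ∣ D'.maninConstant)) :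
    padicValNat 3 (AddSubgroup.zmultiples P).index = 0 := by
  obtain ⟨hf, hm⟩ := Supersingular.nsmul_some_eq_of_ladderRunQ h₀ steps hrun
  exact o5_index_unit_of_good_companion_heegnerIndex_cert hKL hmod W G hcong hρ hadd hunitW hunitG htam hgoodG
    D D' K hK hH hH' h3K hd H H' ι ι₃ P P' hP hP' hPinf hP'inf (.some x₀ y₀ h₀) hm hk hx hmk hIdx hcD hc3'

end Summit.BirchSwinnertonDyer.Rank1Residual.O5.HeegnerLogTransport

end
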